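import Summits.CriticalPhenomena.PercolationContinuityZ3.Theorems.PercNearOneGluingNoHeavyLowerTailSahiGridPatternTwoOrthantTop

/-!
# `NoHeavyLowerTail` (crux stmt-CriticalPhenomena-4575), Sahi programme P1: **THE THREE-BLOCK STAR CERTIFICATE** (preliminaries) —
# two threshold-2 literals and an orthant: the certificate, its nonnegativity, condition (T), and the reduction of (N) to a core inequality

Support file (Sahi cell, seat `prim-sahi-p1`, generation 22; `--supports stmt-CriticalPhenomena-4575`).  Pure proofs, no definitions,
no `sorry`, standard axioms.  Vocabulary of `…SahiGridPattern{CellForm,DiagCert,PairCert,TwoOrthant}`.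

THE SETTING (nested gluing).  Level 2: `[3]^{k+1} = [3]^k × [3]^1` (`glue t p`), `X₂` free-measurable with trace the orthant `↑b ⊆ [3]^k`,
`Y₂` cell-measurable with trace the literal `↑ℓ = {2} ⊆ [3]^1` (`ℓ 0 = 2`); `U' = X₂ ∪ Y₂ = {t ≥ b} ∪ {p = 2}`.  Level 3:
`[3]^{1+(k+1)} = [3]^1 × [3]^{k+1}` (`glue ξ z`), `X₃` free-measurable with trace `↑ℓ` (the literal `{ξ = 2}`), `Y₃` cell-measurable with
trace `U'`; `U = X₃ ∪ Y₃ = {ξ = 2} ∪ {p = 2} ∪ {t ≥ b}` — the THREE-BLOCK STAR with two threshold-2 literal blocks and one orthant block.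
THE CERTIFICATE (generation 21 memo §8.6, found by a joint LP; closed form and roles fixed in generation 22):
  `d(x) = d_pair(x) + δ(x)`,  `δ(glue ξ z) = [ξ ≠ 2]·(d'(z) − 2^{k+1}·1_{U'}(z))`,
where `d_pair` is the pair certificate of `X₃ ∪ Y₃` (`X₃` pays, `…PairCert`) and `d'` the pair certificate of `X₂ ∪ Y₂` (the ORTHANT pays).
Equivalently: on the section `ξ = 2`, `d = 2(2^{k+1} + 2^{k+1}1_{U'} − ν_{U'})`; on the sections `ξ = 0, 1`, `d = 2^{k+1}1_{U'} + d'`.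
THIS FILE: `d ≥ 0` (`threeStar_cert_nonneg`); CONDITION (T) of `…DiagCert` for `d` in every dimension (`threeStar_cert_T`: the slack is
`2^{k+1} Σ_z (1−1_{U'}(z))(2·1_W(2,z) − 1_W(0,z) − 1_W(1,z))` (chains) `+ Σ_{ξ∈{0,1}} [(T)-slack of d' at the section W_ξ]` (`pairCert_T`));
and the reduction of condition (N) to the CORE INEQUALITY `0 ≤ [sStarD U A A' − Φ(A∩A')] + Σ_{A∩A'} δ` (`threeStar_N_of_core`), whose proof
(a `J`-uniform kernel identity) is in `…ThreeStarKernel` / `…ThreeStar`.  Small tools: explicit sums over `[3]^1`. [this work]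
-/

namespace Summit.CriticalPhenomena.PercolationContinuityZ3.Theorems.SahiGridPattern

open Finset SahiGrid3
open scoped BigOperators

variable {k : ℕ}

/-! ### Explicit sums over `[3]^1` -/

/-- A sum over `[3]^1` has three terms. [this work] -/
theorem sum_pd1 {M : Type*} [AddCommMonoid M] (f : Pd 1 → M) :
    (∑ x : Pd 1, f x) = f (fun _ => 0) + f (fun _ => 1) + f (fun _ => 2) := by
  rw [← (Equiv.funUnique (Fin 1) (Fin 3)).symm.sum_comp f, Fin.sum_univ_three]
  rfl

/-- The values of `TotDist` and `thirdPt` on `[3]^1` (bookkeeping). [this work] -/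
theorem pd1_facts :
    TotDist (fun _ => (0:Fin 3) : Pd 1) (fun _ => 0) = false ∧ TotDist (fun _ => (1:Fin 3) : Pd 1) (fun _ => 1) = false ∧
    TotDist (fun _ => (2:Fin 3) : Pd 1) (fun _ => 2) = false ∧
    TotDist (fun _ => (0:Fin 3) : Pd 1) (fun _ => 1) = true ∧ TotDist (fun _ => (0:Fin 3) : Pd 1) (fun _ => 2) = true ∧
    TotDist (fun _ => (1:Fin 3) : Pd 1) (fun _ => 0) = true ∧ TotDist (fun _ => (1:Fin 3) : Pd 1) (fun _ => 2) = true ∧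
    TotDist (fun _ => (2:Fin 3) : Pd 1) (fun _ => 0) = true ∧ TotDist (fun _ => (2:Fin 3) : Pd 1) (fun _ => 1) = true ∧
    thirdPt (fun _ => (0:Fin 3) : Pd 1) (fun _ => 1) = (fun _ => 2) ∧ thirdPt (fun _ => (0:Fin 3) : Pd 1) (fun _ => 2) = (fun _ => 1) ∧
    thirdPt (fun _ => (1:Fin 3) : Pd 1) (fun _ => 0) = (fun _ => 2) ∧ thirdPt (fun _ => (1:Fin 3) : Pd 1) (fun _ => 2) = (fun _ => 0) ∧
    thirdPt (fun _ => (2:Fin 3) : Pd 1) (fun _ => 0) = (fun _ => 1) ∧ thirdPt (fun _ => (2:Fin 3) : Pd 1) (fun _ => 1) = (fun _ => 0) := by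
  refine ⟨by decide, by decide, by decide, by decide, by decide, by decide, by decide, by decide, by decide,
    by decide, by decide, by decide, by decide, by decide, by decide⟩

/-- **The pair sum over `[3]^1` is a sum over the six orderings of `(0,1,2)`.** [this work] -/
theorem pairSum_pd1 (f : Pd 1 → Pd 1 → Pd 1 → ℤ) :
    (∑ p : Pd 1, ∑ p' : Pd 1, (if TotDist p p' = true then (1:ℤ) else 0) * f p p' (thirdPt p p')) =
      f (fun _ => 0) (fun _ => 1) (fun _ => 2) + f (fun _ => 0) (fun _ => 2) (fun _ => 1) + f (fun _ => 1) (fun _ => 0) (fun _ => 2)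
      + f (fun _ => 1) (fun _ => 2) (fun _ => 0) + f (fun _ => 2) (fun _ => 0) (fun _ => 1) + f (fun _ => 2) (fun _ => 1) (fun _ => 0) := by
  obtain ⟨h00, h11, h22, h01, h02, h10, h12, h20, h21, t01, t02, t10, t12, t20, t21⟩ := pd1_facts
  simp only [sum_pd1, h00, h11, h22, h01, h02, h10, h12, h20, h21, t01, t02, t10, t12, t20, t21]
  simp only [if_true, Bool.false_eq_true, if_false, zero_mul, one_mul, zero_add, add_zero]
  ring

/-- Membership in the literal `↑ℓ = {2} ⊆ [3]^1` (`ℓ 0 = 2`). [this work] -/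
theorem mem_literalTwo_iff (ℓ : Pd 1) (hℓ : ℓ 0 = 2) (x : Pd 1) :
    x ∈ (univ.filter fun y : Pd 1 => ∀ j, ℓ j ≤ y j) ↔ x 0 = 2 := by
  simp only [Finset.mem_filter, Finset.mem_univ, true_and, Fin.forall_fin_one, hℓ]
  have h : ∀ u : Fin 3, (2 : Fin 3) ≤ u ↔ u = 2 := by decide
  exact h (x 0)

/-- Indicator values of the literal `{2} ⊆ [3]^1` at the three points. [this work] -/
theorem ind_literalTwo_vals (ℓ : Pd 1) (hℓ : ℓ 0 = 2) :
    ind (univ.filter fun y : Pd 1 => ∀ j, ℓ j ≤ y j) (fun _ => 0) = 0 ∧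
    ind (univ.filter fun y : Pd 1 => ∀ j, ℓ j ≤ y j) (fun _ => 1) = 0 ∧
    ind (univ.filter fun y : Pd 1 => ∀ j, ℓ j ≤ y j) (fun _ => 2) = 1 := by
  refine ⟨?_, ?_, ?_⟩
  · unfold ind; rw [if_neg]; intro h
    have h' := (mem_literalTwo_iff ℓ hℓ _).1 h
    exact absurd h' (by decide)
  · unfold ind; rw [if_neg]; intro h
    have h' := (mem_literalTwo_iff ℓ hℓ _).1 h
    exact absurd h' (by decide)
  · unfold ind; rw [if_pos]
    exact (mem_literalTwo_iff ℓ hℓ _).2 rfl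

/-- `ν`-values of the literal `{2} ⊆ [3]^1`: `ν(0) = ν(1) = 1`, `ν(2) = 0`. [this work] -/
theorem nuCount_literalTwo_vals (ℓ : Pd 1) (hℓ : ℓ 0 = 2) :
    (nuCount (univ.filter fun y : Pd 1 => ∀ j, ℓ j ≤ y j) (fun _ => 0) : ℤ) = 1 ∧
    (nuCount (univ.filter fun y : Pd 1 => ∀ j, ℓ j ≤ y j) (fun _ => 1) : ℤ) = 1 ∧
    (nuCount (univ.filter fun y : Pd 1 => ∀ j, ℓ j ≤ y j) (fun _ => 2) : ℤ) = 0 := by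
  obtain ⟨i0, i1, i2⟩ := ind_literalTwo_vals ℓ hℓ
  obtain ⟨h00, h11, h22, h01, h02, h10, h12, h20, h21, -⟩ := pd1_facts
  refine ⟨?_, ?_, ?_⟩ <;>
  · rw [nuCount_eq_sum_ind, sum_pd1, i0, i1, i2]
    simp [h00, h11, h22, h01, h02, h10, h12, h20, h21]

/-- Indicator of a glued point in the literal block `X₃`: `1_{X₃}(glue ξ z) = [ξ 0 = 2]` at the three values of `ξ`. [this work] -/
theorem ind_free_literal_vals {X : Finset (Pd (1 + (k + 1)))} (ℓ : Pd 1) (hℓ : ℓ 0 = 2)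
    (hX : ∀ ξ z, glue ξ z ∈ X ↔ ξ ∈ (univ.filter fun y : Pd 1 => ∀ j, ℓ j ≤ y j)) (z : Pd (k + 1)) :
    ind X (glue (fun _ => 0) z) = 0 ∧ ind X (glue (fun _ => 1) z) = 0 ∧ ind X (glue (fun _ => 2) z) = 1 := by
  obtain ⟨i0, i1, i2⟩ := ind_literalTwo_vals ℓ hℓ
  rw [ind_glue_of_free hX, ind_glue_of_free hX, ind_glue_of_free hX]
  exact ⟨i0, i1, i2⟩

/-! ### The certificate: nonnegativity -/

/-- **The three-block star certificate is nonnegative** (every `k`): `d = d_pair + δ ≥ 0`. [this work] -/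
theorem threeStar_cert_nonneg {X₂ Y₂ : Finset (Pd (k + 1))} {X₃ Y₃ : Finset (Pd (1 + (k + 1)))}
    (hY₃ : ∀ ξ z, glue ξ z ∈ Y₃ ↔ z ∈ X₂ ∪ Y₂) (x : Pd (1 + (k + 1))) :
    0 ≤ (2:ℤ) ^ (1 + (k + 1)) * (ind X₃ x + ind Y₃ x) - ind X₃ x * ((nuCount (X₃ ∪ Y₃) x : ℤ) - nuCount X₃ x)
        - ind X₃ x * ind Y₃ x * (nuCount X₃ x : ℤ)
        + (1 - ind X₃ x) * (((2:ℤ) ^ (k + 1) * (ind X₂ (cellOf x) + ind Y₂ (cellOf x))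
            - ind X₂ (cellOf x) * ((nuCount (X₂ ∪ Y₂) (cellOf x) : ℤ) - nuCount X₂ (cellOf x))
            - ind X₂ (cellOf x) * ind Y₂ (cellOf x) * (nuCount X₂ (cellOf x) : ℤ))
          - 2 ^ (k + 1) * ind (X₂ ∪ Y₂) (cellOf x)) := by
  have h3 := pairCert_nonneg X₃ Y₃ x
  have h2 := pairCert_nonneg X₂ Y₂ (cellOf x)
  by_cases hx : x ∈ X₃
  · have e : ind X₃ x = 1 := by unfold ind; rw [if_pos hx]
    rw [e] at h3 ⊢
    nlinarith [h3]
  · have e : ind X₃ x = 0 := by unfold ind; rw [if_neg hx]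
    have eY : ind Y₃ x = ind (X₂ ∪ Y₂) (cellOf x) := by
      have hm : x ∈ Y₃ ↔ cellOf x ∈ X₂ ∪ Y₂ := by
        have := hY₃ (freeOf x) (cellOf x); rwa [glue_freeOf_cellOf] at this
      unfold ind
      by_cases hy : x ∈ Y₃
      · rw [if_pos hy, if_pos (hm.1 hy)]
      · rw [if_neg hy, if_neg (fun h => hy (hm.2 h))]
    rw [e, eY]
    have hU := ind_nonneg' (X₂ ∪ Y₂) (cellOf x)
    have hp : (2:ℤ) ^ (1 + (k + 1)) = 2 * 2 ^ (k + 1) := by rw [pow_add]; ring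
    rw [hp]
    nlinarith [h2, hU, pow_nonneg (show (0:ℤ) ≤ 2 by norm_num) (k + 1)]

/-! ### Condition (T) -/

/-- **CONDITION (T) FOR THE THREE-BLOCK STAR CERTIFICATE** (every `k`): for every up-set `W ⊆ [3]^{1+(k+1)}`,
`Σ_{x∈W} d(x) ≤ Σ_{x∈W} λ_U(x)`.  The slack is `2^{k+1}Σ_z(1−1_{U'}(z))(2·1_W(glue 2 z) − 1_W(glue 0 z) − 1_W(glue 1 z))`
(nonnegative on up-sets: chains) plus the level-2 (T)-slacks of `d'` at the sections `W_0, W_1` (`pairCert_T`). [this work] -/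
theorem threeStar_cert_T (b : Pd k) (ℓ : Pd 1) (hℓ : ℓ 0 = 2) {X₂ Y₂ : Finset (Pd (k + 1))} {X₃ Y₃ : Finset (Pd (1 + (k + 1)))}
    (hX₂ : ∀ t p, glue t p ∈ X₂ ↔ t ∈ (univ.filter fun x : Pd k => ∀ j, b j ≤ x j))
    (hY₂ : ∀ t p, glue t p ∈ Y₂ ↔ p ∈ (univ.filter fun y : Pd 1 => ∀ j, ℓ j ≤ y j))
    (hX₃ : ∀ ξ z, glue ξ z ∈ X₃ ↔ ξ ∈ (univ.filter fun y : Pd 1 => ∀ j, ℓ j ≤ y j))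
    (hY₃ : ∀ ξ z, glue ξ z ∈ Y₃ ↔ z ∈ X₂ ∪ Y₂)
    (W : Finset (Pd (1 + (k + 1)))) (hW : IsUpperSet (W : Set (Pd (1 + (k + 1))))) :
    (∑ x ∈ W, ((2:ℤ) ^ (1 + (k + 1)) * (ind X₃ x + ind Y₃ x) - ind X₃ x * ((nuCount (X₃ ∪ Y₃) x : ℤ) - nuCount X₃ x)
        - ind X₃ x * ind Y₃ x * (nuCount X₃ x : ℤ)
        + (1 - ind X₃ x) * (((2:ℤ) ^ (k + 1) * (ind X₂ (cellOf x) + ind Y₂ (cellOf x))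
            - ind X₂ (cellOf x) * ((nuCount (X₂ ∪ Y₂) (cellOf x) : ℤ) - nuCount X₂ (cellOf x))
            - ind X₂ (cellOf x) * ind Y₂ (cellOf x) * (nuCount X₂ (cellOf x) : ℤ))
          - 2 ^ (k + 1) * ind (X₂ ∪ Y₂) (cellOf x))))
      ≤ ∑ x ∈ W, lamU (X₃ ∪ Y₃) x := by
  set L : Finset (Pd 1) := univ.filter fun y : Pd 1 => ∀ j, ℓ j ≤ y j with hL
  set Ob : Finset (Pd k) := univ.filter fun x : Pd k => ∀ j, b j ≤ x j with hOb
  set U' : Finset (Pd (k + 1)) := X₂ ∪ Y₂ with hU'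
  set d₂ : Pd (k + 1) → ℤ := fun z => (2:ℤ) ^ (k + 1) * (ind X₂ z + ind Y₂ z) - ind X₂ z * ((nuCount (X₂ ∪ Y₂) z : ℤ) - nuCount X₂ z)
      - ind X₂ z * ind Y₂ z * (nuCount X₂ z : ℤ) with hd₂
  have hLup : IsUpperSet (L : Set (Pd 1)) := by rw [hL]; exact isUpperSet_filter_le ℓ
  have hObup : IsUpperSet (Ob : Set (Pd k)) := by rw [hOb]; exact isUpperSet_filter_le b
  have hU'up : IsUpperSet (U' : Set (Pd (k + 1))) := by
    rw [hU', Finset.coe_union]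
    refine IsUpperSet.union ?_ ?_
    · intro z z' hle hz
      rw [Finset.mem_coe] at hz ⊢
      rw [← glue_freeOf_cellOf z] at hz; rw [← glue_freeOf_cellOf z']
      rw [hX₂] at hz ⊢
      exact hObup (fun a => by simpa [freeOf] using hle (Fin.castAdd 1 a)) hz
    · intro z z' hle hz
      rw [Finset.mem_coe] at hz ⊢
      rw [← glue_freeOf_cellOf z] at hz; rw [← glue_freeOf_cellOf z']
      rw [hY₂] at hz ⊢
      exact hLup (fun a => by simpa [cellOf] using hle (Fin.natAdd k a)) hz
  -- (T)-slack of the pair certificate of `X₃ ∪ Y₃`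
  have eΦ := pairCert_slack_eq hX₃ hY₃ W
  -- it suffices to bound the `δ`-part by `Φ(W)`
  rw [Finset.sum_add_distrib]
  rw [Finset.sum_sub_distrib] at eΦ
  suffices hδ : (∑ x ∈ W, (1 - ind X₃ x) * (((2:ℤ) ^ (k + 1) * (ind X₂ (cellOf x) + ind Y₂ (cellOf x))
            - ind X₂ (cellOf x) * ((nuCount (X₂ ∪ Y₂) (cellOf x) : ℤ) - nuCount X₂ (cellOf x))
            - ind X₂ (cellOf x) * ind Y₂ (cellOf x) * (nuCount X₂ (cellOf x) : ℤ))
          - 2 ^ (k + 1) * ind (X₂ ∪ Y₂) (cellOf x)))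
      ≤ 2 ^ (k + 1) * (∑ z : Pd (k + 1), (1 - ind (X₂ ∪ Y₂) z) * ∑ ξ : Pd 1, ind (fibre W z) ξ * (2 ^ 1 * ind L ξ - (nuCount L ξ : ℤ)))
        + ∑ ξ : Pd 1, (1 - ind L ξ) * (2 ^ 1 - (nuCount L ξ : ℤ)) *
            ∑ z : Pd (k + 1), ind (sect W ξ) z * (2 ^ (k + 1) * ind (X₂ ∪ Y₂) z - (nuCount (X₂ ∪ Y₂) z : ℤ)) by
    linarith
  obtain ⟨i0, i1, i2⟩ := ind_literalTwo_vals ℓ hℓ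
  obtain ⟨n0, n1, n2⟩ := nuCount_literalTwo_vals ℓ hℓ
  -- explicit form of the three `ξ`-sums
  have eδ : (∑ x ∈ W, (1 - ind X₃ x) * (((2:ℤ) ^ (k + 1) * (ind X₂ (cellOf x) + ind Y₂ (cellOf x))
            - ind X₂ (cellOf x) * ((nuCount (X₂ ∪ Y₂) (cellOf x) : ℤ) - nuCount X₂ (cellOf x))
            - ind X₂ (cellOf x) * ind Y₂ (cellOf x) * (nuCount X₂ (cellOf x) : ℤ))
          - 2 ^ (k + 1) * ind (X₂ ∪ Y₂) (cellOf x)))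
      = (∑ z : Pd (k + 1), ind W (glue (fun _ => 0) z) * (d₂ z - 2 ^ (k + 1) * ind U' z))
        + ∑ z : Pd (k + 1), ind W (glue (fun _ => 1) z) * (d₂ z - 2 ^ (k + 1) * ind U' z) := by
    rw [sum_mem_eq_sum_ind_mul, sum_glue, sum_pd1]
    simp only [cellOf_glue, (ind_free_literal_vals ℓ hℓ hX₃ _).1, (ind_free_literal_vals ℓ hℓ hX₃ _).2.1,
      (ind_free_literal_vals ℓ hℓ hX₃ _).2.2, hd₂, hU']
    have hz : (∑ z : Pd (k + 1), ind W (glue (fun _ => (2:Fin 3)) z) * ((1 - 1) *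
        ((2:ℤ) ^ (k + 1) * (ind X₂ z + ind Y₂ z) - ind X₂ z * ((nuCount (X₂ ∪ Y₂) z : ℤ) - nuCount X₂ z)
          - ind X₂ z * ind Y₂ z * (nuCount X₂ z : ℤ) - 2 ^ (k + 1) * ind (X₂ ∪ Y₂) z))) = 0 :=
      Finset.sum_eq_zero fun z _ => by ring
    rw [hz, add_zero, ← Finset.sum_add_distrib, ← Finset.sum_add_distrib]
    refine Finset.sum_congr rfl fun z _ => ?_
    ring
  have eA : (∑ z : Pd (k + 1), (1 - ind (X₂ ∪ Y₂) z) * ∑ ξ : Pd 1, ind (fibre W z) ξ * (2 ^ 1 * ind L ξ - (nuCount L ξ : ℤ)))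
      = ∑ z : Pd (k + 1), (1 - ind U' z) * (2 * ind W (glue (fun _ => 2) z) - ind W (glue (fun _ => 0) z) - ind W (glue (fun _ => 1) z)) := by
    refine Finset.sum_congr rfl fun z _ => ?_
    rw [sum_pd1, ind_fibre, ind_fibre, ind_fibre, i0, i1, i2, n0, n1, n2, hU']
    ring
  have eB : (∑ ξ : Pd 1, (1 - ind L ξ) * (2 ^ 1 - (nuCount L ξ : ℤ)) *
            ∑ z : Pd (k + 1), ind (sect W ξ) z * (2 ^ (k + 1) * ind (X₂ ∪ Y₂) z - (nuCount (X₂ ∪ Y₂) z : ℤ)))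
      = (∑ z : Pd (k + 1), ind W (glue (fun _ => 0) z) * (2 ^ (k + 1) * ind U' z - (nuCount U' z : ℤ)))
        + ∑ z : Pd (k + 1), ind W (glue (fun _ => 1) z) * (2 ^ (k + 1) * ind U' z - (nuCount U' z : ℤ)) := by
    rw [sum_pd1, i0, i1, i2, n0, n1, n2, hU']
    simp only [ind_sect]
    ring
  rw [eδ, eA, eB]
  -- the chain part is nonnegative
  have hchain : 0 ≤ ∑ z : Pd (k + 1), (1 - ind U' z) *
      (2 * ind W (glue (fun _ => 2) z) - ind W (glue (fun _ => 0) z) - ind W (glue (fun _ => 1) z)) := by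
    refine Finset.sum_nonneg fun z _ => mul_nonneg (by linarith [ind_le_one' U' z]) ?_
    have c02 : ((fun _ => 0 : Pd 1) ≤ fun _ => 2) := fun _ => by show (0 : Fin 3) ≤ 2; decide
    have c12 : ((fun _ => 1 : Pd 1) ≤ fun _ => 2) := fun _ => by show (1 : Fin 3) ≤ 2; decide
    have le0 : ind W (glue (fun _ => 0) z) ≤ ind W (glue (fun _ => 2) z) :=
      ind_le_ind_of_imp fun h => hW (glue_le_glue_iff.2 ⟨c02, le_rfl⟩) h
    have le1 : ind W (glue (fun _ => 1) z) ≤ ind W (glue (fun _ => 2) z) :=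
      ind_le_ind_of_imp fun h => hW (glue_le_glue_iff.2 ⟨c12, le_rfl⟩) h
    linarith
  -- the two level-2 (T)-slacks are nonnegative
  have hsec : ∀ ξ : Pd 1, (∑ z : Pd (k + 1), ind W (glue ξ z) * (d₂ z - 2 ^ (k + 1) * ind U' z))
      ≤ ∑ z : Pd (k + 1), ind W (glue ξ z) * (2 ^ (k + 1) * ind U' z - (nuCount U' z : ℤ)) := by
    intro ξ
    have hT := pairCert_T hX₂ hY₂ hObup hLup (sect W ξ) (isUpperSet_sect hW ξ)
    rw [sum_mem_eq_sum_ind_mul (sect W ξ), sum_mem_eq_sum_ind_mul (sect W ξ)] at hT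
    simp only [ind_sect] at hT
    have e1 : (∑ z : Pd (k + 1), ind W (glue ξ z) * (2 ^ (k + 1) * ind U' z - (nuCount U' z : ℤ)))
        - (∑ z : Pd (k + 1), ind W (glue ξ z) * (d₂ z - 2 ^ (k + 1) * ind U' z))
        = (∑ z : Pd (k + 1), ind W (glue ξ z) * lamU (X₂ ∪ Y₂) z)
          - ∑ z : Pd (k + 1), ind W (glue ξ z) * ((2:ℤ) ^ (k + 1) * (ind X₂ z + ind Y₂ z)
              - ind X₂ z * ((nuCount (X₂ ∪ Y₂) z : ℤ) - nuCount X₂ z) - ind X₂ z * ind Y₂ z * (nuCount X₂ z : ℤ)) := by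
      rw [← Finset.sum_sub_distrib, ← Finset.sum_sub_distrib]
      refine Finset.sum_congr rfl fun z _ => ?_
      rw [hd₂, hU']; unfold lamU; ring
    linarith
  have h0 := hsec (fun _ => 0)
  have h1 := hsec (fun _ => 1)
  have hpos : (0:ℤ) ≤ 2 ^ (k + 1) := pow_nonneg (by norm_num) _
  have hc := mul_nonneg hpos hchain
  linarith

/-! ### Condition (N) from the core inequality -/

/-- **Condition (N) for the three-block star certificate from the CORE INEQUALITY**: if for all up-sets `A, A'`
`0 ≤ [sStarD (X₃∪Y₃) A A' − Φ(A∩A')] + Σ_{x∈A∩A'} δ(x)` (`Φ` the closed-form (T)-slack of the pair certificate, `pairCert_slack_eq`),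
then `Θ_U(A×A') ≤ Σ_{A∩A'} d` for all up-sets. [this work] -/
theorem threeStar_N_of_core {X₂ Y₂ : Finset (Pd (k + 1))} {X₃ Y₃ : Finset (Pd (1 + (k + 1)))} {L : Finset (Pd 1)}
    (hX₃ : ∀ ξ z, glue ξ z ∈ X₃ ↔ ξ ∈ L) (hY₃ : ∀ ξ z, glue ξ z ∈ Y₃ ↔ z ∈ X₂ ∪ Y₂)
    (hcore : ∀ A A' : Finset (Pd (1 + (k + 1))), IsUpperSet (A : Set (Pd (1 + (k + 1)))) → IsUpperSet (A' : Set (Pd (1 + (k + 1)))) →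
      0 ≤ (sStarD (X₃ ∪ Y₃) A A'
        - (2 ^ (k + 1) * (∑ z : Pd (k + 1), (1 - ind (X₂ ∪ Y₂) z) * ∑ ξ : Pd 1, ind (fibre (A ∩ A') z) ξ * (2 ^ 1 * ind L ξ - (nuCount L ξ : ℤ)))
          + (∑ ξ : Pd 1, (1 - ind L ξ) * (2 ^ 1 - (nuCount L ξ : ℤ)) *
              ∑ z : Pd (k + 1), ind (sect (A ∩ A') ξ) z * (2 ^ (k + 1) * ind (X₂ ∪ Y₂) z - (nuCount (X₂ ∪ Y₂) z : ℤ)))))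
        + ∑ x ∈ A ∩ A', (1 - ind X₃ x) * (((2:ℤ) ^ (k + 1) * (ind X₂ (cellOf x) + ind Y₂ (cellOf x))
            - ind X₂ (cellOf x) * ((nuCount (X₂ ∪ Y₂) (cellOf x) : ℤ) - nuCount X₂ (cellOf x))
            - ind X₂ (cellOf x) * ind Y₂ (cellOf x) * (nuCount X₂ (cellOf x) : ℤ))
          - 2 ^ (k + 1) * ind (X₂ ∪ Y₂) (cellOf x))) :
    ∀ A A' : Finset (Pd (1 + (k + 1))), IsUpperSet (A : Set (Pd (1 + (k + 1)))) → IsUpperSet (A' : Set (Pd (1 + (k + 1)))) →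
      (∑ q ∈ A, ∑ r ∈ A', thetaVal (X₃ ∪ Y₃) q r) ≤
        ∑ x ∈ A ∩ A', (((2:ℤ) ^ (1 + (k + 1)) * (ind X₃ x + ind Y₃ x) - ind X₃ x * ((nuCount (X₃ ∪ Y₃) x : ℤ) - nuCount X₃ x)
        - ind X₃ x * ind Y₃ x * (nuCount X₃ x : ℤ)
        + (1 - ind X₃ x) * (((2:ℤ) ^ (k + 1) * (ind X₂ (cellOf x) + ind Y₂ (cellOf x))
            - ind X₂ (cellOf x) * ((nuCount (X₂ ∪ Y₂) (cellOf x) : ℤ) - nuCount X₂ (cellOf x))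
            - ind X₂ (cellOf x) * ind Y₂ (cellOf x) * (nuCount X₂ (cellOf x) : ℤ))
          - 2 ^ (k + 1) * ind (X₂ ∪ Y₂) (cellOf x)))) := by
  intro A A' hA hA'
  have h1 := sStarD_eq_sum_lamU_sub_sum_thetaVal (X₃ ∪ Y₃) A A'
  have h2 := pairCert_slack_eq hX₃ hY₃ (A ∩ A')
  have h3 := hcore A A' hA hA'
  rw [Finset.sum_sub_distrib] at h2
  rw [Finset.sum_add_distrib]
  linarith

end Summit.CriticalPhenomena.PercolationContinuityZ3.Theorems.SahiGridPattern
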